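import Summits.BirchSwinnertonDyer.BirchSwinnertonDyer.Theorems.ThetaPartnerAtTwoSignedKatoUpToAtTwoHondaLogCharSums
import HarnessLib

/-!
# Route `ThetaPartnerAtTwo` (TP2), crux K3 `SignedKatoDivisibilityUpToAtTwo` (item stmt-BirchSwinnertonDyer-20308), line `colemanrat` —
# (R3) part 2: KOBAYASHI PROP. 8.26 AS CYCLOTOMIC ALGEBRA — the character sums of the conjugates of
# `ℓ_N = ∑_{k<N} (−1)^k (ζ_{p^{N−2k}} − 1)/p^k` are `±p^k ×` a primitive Gauss sum, and vanish in the wrong parity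

Width seat `bsd-wall-tp2-p2x-w2` g5 (cell `bsd-wall`). HONEST FRAMING: theorems only (no definition, no named fact, no instance,
no `sorry`); generic algebra in a field `R` containing a primitive `p^N`-th root of unity — nothing about any curve is asserted; closes
no item; K3 is NOT settled and BSD is NOT proved by any of this.

## What is here (sequel of `…HondaLogCharSums`, same namespace)

Kobayashi's logarithm values of the Honda/tower points are `log c_m = ℓ_m = ∑_{k<m} (−1)^k (ζ_{p^{m−2k}} − 1)/p^k` (Invent. Math. 152,
§8.4; tree: `Rank1Residual/Additive/KobayashiTowerPoints.ell`, `…LocalTowerPoints`, and at `p = 2` the plus points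
`d_n = 3(c_{n+2} + σ c_{n+2}) − 2c_1` of `…LocalTwoPlusPoints` with `log d_n = 3(ℓ_{n+2} + σℓ_{n+2}) + 4`). For `σ_a ∈ Gal` with
`σ_a(ζ_{p^j}) = ζ_{p^j}^a` one has `σ_a(ℓ_N) = ∑_{k<N} (−1)^k (ζ_{p^{N−2k}}^a − 1)/p^k`, and with `ζ_{p^{N−2k}} = ζ^{p^{2k}}` for a primitive
`p^N`-th root `ζ` this file proves, for a character `χ = χ_c ∘ (ℤ/p^N → ℤ/p^c)` with `χ_c` PRIMITIVE of level `p^c`, `1 ≤ c ≤ N`: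

* `sum_changeLevel_mul_pow_eq_zero_of_lt` / `_of_gt` / `sum_changeLevel_mul_pow_eq_of_eq` — the single sums
  `∑_{a mod p^N} χ(a) (ζ^{p^j})^a` vanish for `j + c ≠ N` and equal `p^j · τ_c` for `j + c = N`, `τ_c = ∑_{b mod p^c} χ_c(b) (ζ^{p^j})^b`
  the primitive Gauss sum (parts 1: level raising / level lowering / imprimitive vanishing);
* **`sum_changeLevel_mul_ellConj`** — `∑_{a mod p^N} χ(a)·σ_a(ℓ_N) = (−1)^k p^k · τ_c` if `N = c + 2k`, and `= 0` if `N − c` is odd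
  (`sum_changeLevel_mul_ellConj_eq_zero`): Kobayashi Prop. 8.26 (i)/(ii) in cyclotomic form, any prime `p` — at `p = 2` this is the
  `±`-parity pattern of the plus/minus Coleman maps (characters of conductor `2^c` see `ℓ_N` only when `c ≡ N (mod 2)`).
What is NOT here: the trivial character (`…HondaLogCharSums` §4 gives its Gauss sums), the dictionary `σ ↦ a(σ)` on the tree's
`zeta 2 m` / the Galois-equivariance of `ptLogΩ` (tree, `…LocalTwoPlusPoints`), and anything about `exp*` (R1′) or Kato's values (R2).

References: [Kobayashi2003] §8.4 (`ℓ_n`), Prop. 8.26 (p. 24); [Washington1997] Lemma 4.7–4.8.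
-/

set_option autoImplicit false
-- the Theorems namespace of this sub repeats the summit name by design (D-0017 nested layout)
set_option linter.dupNamespace false

noncomputable section

open scoped Classical

open DirichletCharacter AddChar Finset

namespace Summit.BirchSwinnertonDyer.BirchSwinnertonDyer.Theorems.SignedKatoOffTwo.HondaLogChi

variable {R : Type*} [Field R] {p : ℕ} [hp : Fact p.Prime]

/-! ## §1 Primitive characters do not factor through lower levels after `changeLevel` -/

/-- If `χ_c` is primitive of level `p^c` and `m < c`, then `χ_c ∘ (ℤ/p^N → ℤ/p^c)` does not factor through `p^m`. [folklore] -/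
theorem not_factorsThrough_changeLevel_of_isPrimitive {c N m : ℕ} (hcN : c ≤ N) (χc : DirichletCharacter R (p ^ c))
    (hprim : χc.IsPrimitive) (hm : m < c) :
    ¬ (changeLevel (pow_dvd_pow p hcN) χc).FactorsThrough (p ^ m) := by
  rintro ⟨hdvd, χm, hχm⟩
  -- `χ_c = χ_m ∘ (ℤ/p^c → ℤ/p^m)` by injectivity of `changeLevel`
  have hmc : p ^ m ∣ p ^ c := pow_dvd_pow p hm.le
  have heq : χc = changeLevel hmc χm := by
    apply changeLevel_injective (pow_dvd_pow p hcN)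
    rw [hχm, ← changeLevel_trans χm hmc (pow_dvd_pow p hcN)]
  have hfac : χc.FactorsThrough (p ^ m) := ⟨hmc, χm, heq⟩
  have hle : χc.conductor ≤ p ^ m := Nat.sInf_le hfac
  rw [hprim] at hle
  exact absurd hle (not_le.mpr (Nat.pow_lt_pow_right hp.out.one_lt hm))

/-- A primitive character of level `p^c`, `c ≥ 1`, lifted to level `p^N`, is not the trivial character. [folklore] -/
theorem changeLevel_ne_one_of_isPrimitive {c N : ℕ} (hc : 1 ≤ c) (hcN : c ≤ N) (χc : DirichletCharacter R (p ^ c))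
    (hprim : χc.IsPrimitive) : changeLevel (pow_dvd_pow p hcN) χc ≠ 1 := by
  intro h1
  have h0 : (changeLevel (pow_dvd_pow p hcN) χc).FactorsThrough (p ^ 0) :=
    ⟨by rw [pow_zero]; exact one_dvd _, 1, by rw [h1, changeLevel_one]⟩
  exact not_factorsThrough_changeLevel_of_isPrimitive hcN χc hprim hc h0

/-! ## §2 The single sums `∑_{a mod p^N} χ(a) (ζ^{p^j})^a` -/

omit hp in
/-- `(ζ^{p^j})^{p^N} = 1` for `ζ^{p^N} = 1`. [folklore] -/
theorem pow_pow_pow_eq_one {N : ℕ} {ζ : R} (hζ : ζ ^ p ^ N = 1) (j : ℕ) : (ζ ^ p ^ j) ^ p ^ N = 1 := by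
  rw [← pow_mul, mul_comm, pow_mul, hζ, one_pow]

/-- **Wrong level, too low**: if `j + c < N` then `∑_{a mod p^N} χ(a) (ζ^{p^j})^a = 0` (`χ` lifted from a primitive `χ_c`, `c ≥ 1`, `ζ`
a primitive `p^N`-th root): level raising to `p^{N−j}` and vanishing of the imprimitive Gauss sum there.
[cite: Kobayashi2003, Prop. 8.26 (i)] [cite: Washington1997, Lemma 4.8] -/
theorem sum_changeLevel_mul_pow_eq_zero_of_lt {c N : ℕ} (hc : 1 ≤ c) (hcN : c ≤ N) (χc : DirichletCharacter R (p ^ c))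
    {ζ : R} (hζ : IsPrimitiveRoot ζ (p ^ N)) {j : ℕ} (hj : j + c < N) :
    ∑ a : ZMod (p ^ N), changeLevel (pow_dvd_pow p hcN) χc a * (ζ ^ p ^ j) ^ a.val = 0 := by
  have hζN : ζ ^ p ^ N = 1 := hζ.pow_eq_one
  have hjN : j ≤ N := by omega
  have hMN : N - j ≤ N := Nat.sub_le N j
  have hcM : c ≤ N - j := by omega
  have hM : 1 ≤ N - j := hc.trans hcM
  -- the root `ζ' = ζ^{p^j}` has `ζ'^{p^{N-j}} = 1` and `ζ'^{p^c} ≠ 1`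
  have hζ' : (ζ ^ p ^ j) ^ p ^ (N - j) = 1 := by
    rw [← pow_mul, ← pow_add, Nat.add_sub_cancel' hjN, hζN]
  have hζ'c : (ζ ^ p ^ j) ^ p ^ c ≠ 1 := by
    rw [← pow_mul, ← pow_add]
    exact hζ.pow_ne_one_of_pos_of_lt (pow_ne_zero _ hp.out.ne_zero) (Nat.pow_lt_pow_right hp.out.one_lt (by omega))
  -- `χ = χ' ∘ (ℤ/p^N → ℤ/p^{N-j})`, `χ' = χ_c ∘ (ℤ/p^{N-j} → ℤ/p^c)` factors through `p^c`, `c < N - j`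
  have htrans : changeLevel (pow_dvd_pow p hcN) χc =
      changeLevel (pow_dvd_pow p hMN) (changeLevel (pow_dvd_pow p hcM) χc) :=
    changeLevel_trans χc (pow_dvd_pow p hcM) (pow_dvd_pow p hMN)
  have h := gaussSum_changeLevel_zmodChar hM hMN (changeLevel (pow_dvd_pow p hcM) χc) (pow_pow_pow_eq_one hζN j) hζ'
  rw [gaussSum_zmodChar_eq_zero_of_factorsThrough hc hcM (changeLevel_factorsThrough χc (pow_dvd_pow p hcM)) hζ' hζ'c,
    mul_zero, ← htrans] at h
  simpa only [gaussSum, zmodChar_apply] using h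

/-- **Wrong level, too high**: if `N < j + c` then `∑_{a mod p^N} χ(a) (ζ^{p^j})^a = 0`: `χ` does not factor through `p^{N−j}`
(primitivity of `χ_c`, `N − j < c`) while `(ζ^{p^j})^{p^{N−j}} = 1`. [cite: Kobayashi2003, Prop. 8.26 (i)] [cite: Washington1997, Lemma 4.7] -/
theorem sum_changeLevel_mul_pow_eq_zero_of_gt {c N : ℕ} (hc : 1 ≤ c) (hcN : c ≤ N) (χc : DirichletCharacter R (p ^ c))
    (hprim : χc.IsPrimitive) {ζ : R} (hζN : ζ ^ p ^ N = 1) {j : ℕ} (hj : N < j + c) :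
    ∑ a : ZMod (p ^ N), changeLevel (pow_dvd_pow p hcN) χc a * (ζ ^ p ^ j) ^ a.val = 0 := by
  have hζ' : (ζ ^ p ^ j) ^ p ^ (N - j) = 1 := by
    rcases Nat.lt_or_ge N j with hjN | hjN
    · rw [Nat.sub_eq_zero_of_le hjN.le, pow_zero, pow_one, ← Nat.add_sub_cancel' hjN.le, pow_add, pow_mul, hζN, one_pow]
    · rw [← pow_mul, ← pow_add, Nat.add_sub_cancel' hjN, hζN]
  have h := gaussSum_zmodChar_eq_zero_of_not_factorsThrough (pow_dvd_pow p (Nat.sub_le N j))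
    (not_factorsThrough_changeLevel_of_isPrimitive hcN χc hprim (by omega : N - j < c)) (pow_pow_pow_eq_one hζN j) hζ'
  simpa only [gaussSum, zmodChar_apply] using h

/-- **Right level**: if `j + c = N` then `∑_{a mod p^N} χ(a) (ζ^{p^j})^a = p^j · ∑_{b mod p^c} χ_c(b) (ζ^{p^j})^b` (level raising; the
right-hand sum is the PRIMITIVE Gauss sum `τ(χ_c)` for the primitive `p^c`-th root `ζ^{p^j}`). [cite: Kobayashi2003, Prop. 8.26 (ii)]
[cite: Washington1997, Lemma 4.8] -/
theorem sum_changeLevel_mul_pow_eq_of_eq {c N : ℕ} (hc : 1 ≤ c) (hcN : c ≤ N) (χc : DirichletCharacter R (p ^ c))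
    {ζ : R} (hζN : ζ ^ p ^ N = 1) {j : ℕ} (hj : j + c = N) (hζc : (ζ ^ p ^ j) ^ p ^ c = 1) :
    ∑ a : ZMod (p ^ N), changeLevel (pow_dvd_pow p hcN) χc a * (ζ ^ p ^ j) ^ a.val =
      (p ^ j : ℕ) * ∑ b : ZMod (p ^ c), χc b * (ζ ^ p ^ j) ^ b.val := by
  have h := gaussSum_changeLevel_zmodChar hc hcN χc (pow_pow_pow_eq_one hζN j) hζc
  rw [show N - c = j by omega] at h
  simpa only [gaussSum, zmodChar_apply] using h

/-! ## §3 Kobayashi Prop. 8.26 in cyclotomic form: the character sums of `σ_a(ℓ_N)` -/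

/-- Expansion: `∑_a χ(a) σ_a(ℓ_N) = ∑_{k<N} (−1)^k p^{−k} (∑_a χ(a)(ζ^{p^{2k}})^a − ∑_a χ(a))`. [cite: Kobayashi2003, §8.4 and Prop. 8.26] -/
theorem sum_mul_ellConj_expand {N : ℕ} (χ : DirichletCharacter R (p ^ N)) (ζ : R) :
    ∑ a : ZMod (p ^ N), χ a * ∑ k ∈ range N, (-1) ^ k * ((ζ ^ p ^ (2 * k)) ^ a.val - 1) / (p : R) ^ k =
      ∑ k ∈ range N, (-1) ^ k / (p : R) ^ k *
        (∑ a : ZMod (p ^ N), χ a * (ζ ^ p ^ (2 * k)) ^ a.val - ∑ a : ZMod (p ^ N), χ a) := by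
  calc ∑ a : ZMod (p ^ N), χ a * ∑ k ∈ range N, (-1) ^ k * ((ζ ^ p ^ (2 * k)) ^ a.val - 1) / (p : R) ^ k
      = ∑ a : ZMod (p ^ N), ∑ k ∈ range N, χ a * ((-1) ^ k * ((ζ ^ p ^ (2 * k)) ^ a.val - 1) / (p : R) ^ k) := by
        simp_rw [Finset.mul_sum]
    _ = ∑ k ∈ range N, ∑ a : ZMod (p ^ N), χ a * ((-1) ^ k * ((ζ ^ p ^ (2 * k)) ^ a.val - 1) / (p : R) ^ k) :=
        Finset.sum_comm
    _ = _ := by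
        refine Finset.sum_congr rfl fun k _ ↦ ?_
        rw [mul_sub, Finset.mul_sum, Finset.mul_sum, ← Finset.sum_sub_distrib]
        refine Finset.sum_congr rfl fun a _ ↦ ?_
        ring

/-- **Kobayashi Prop. 8.26, even case (`N = c + 2k`)**: for `χ` lifted from a primitive `χ_c` of level `p^c` (`c ≥ 1`) and `ζ` a
primitive `p^N`-th root of unity, `∑_{a mod p^N} χ(a)·σ_a(ℓ_N) = (−1)^k p^k · ∑_{b mod p^c} χ_c(b) (ζ^{p^{2k}})^b` — only the term
`k` with `p^{N−2k} = p^c` survives, carrying the primitive Gauss sum of `χ_c`. [cite: Kobayashi2003, Prop. 8.26 (ii) (p. 24)] -/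
theorem sum_changeLevel_mul_ellConj {c N k₀ : ℕ} (hc : 1 ≤ c) (hN : N = c + 2 * k₀) (χc : DirichletCharacter R (p ^ c))
    (hprim : χc.IsPrimitive) {ζ : R} (hζ : IsPrimitiveRoot ζ (p ^ N)) (hζc : (ζ ^ p ^ (2 * k₀)) ^ p ^ c = 1)
    (hpR : (p : R) ≠ 0) :
    ∑ a : ZMod (p ^ N), changeLevel (pow_dvd_pow p (by omega : c ≤ N)) χc a *
        ∑ k ∈ range N, (-1) ^ k * ((ζ ^ p ^ (2 * k)) ^ a.val - 1) / (p : R) ^ k =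
      (-1) ^ k₀ * (p : R) ^ k₀ * ∑ b : ZMod (p ^ c), χc b * (ζ ^ p ^ (2 * k₀)) ^ b.val := by
  have hcN : c ≤ N := by omega
  have hζN : ζ ^ p ^ N = 1 := hζ.pow_eq_one
  have hne : changeLevel (pow_dvd_pow p hcN) χc ≠ 1 := changeLevel_ne_one_of_isPrimitive hc hcN χc hprim
  rw [sum_mul_ellConj_expand, MulChar.sum_eq_zero_of_ne_one hne]
  simp only [sub_zero]
  rw [Finset.sum_eq_single k₀]
  · rw [sum_changeLevel_mul_pow_eq_of_eq hc hcN χc hζN (by omega : 2 * k₀ + c = N) hζc]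
    have hpk : (p : R) ^ k₀ ≠ 0 := pow_ne_zero _ hpR
    rw [Nat.cast_pow, pow_mul, ← mul_assoc]
    congr 1
    field_simp
    ring
  · intro k _ hk
    rcases Nat.lt_or_gt_of_ne hk with hlt | hgt
    · rw [sum_changeLevel_mul_pow_eq_zero_of_lt hc hcN χc hζ (by omega : 2 * k + c < N), mul_zero]
    · rw [sum_changeLevel_mul_pow_eq_zero_of_gt hc hcN χc hprim hζN (by omega : N < 2 * k + c), mul_zero]
  · intro hk₀
    exact absurd (Finset.mem_range.mpr (by omega : k₀ < N)) hk₀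

/-- **Kobayashi Prop. 8.26, odd case**: if `N − c` is odd (no `k` with `N = c + 2k`), then `∑_{a mod p^N} χ(a)·σ_a(ℓ_N) = 0` — the
character `χ` of conductor `p^c` does not see `ℓ_N`. At `p = 2` this is why the plus (resp. minus) Coleman map only involves characters
of one parity of conductor exponent. [cite: Kobayashi2003, Prop. 8.26 (i) (p. 24)] -/
theorem sum_changeLevel_mul_ellConj_eq_zero {c N : ℕ} (hc : 1 ≤ c) (hcN : c ≤ N) (hodd : ∀ k : ℕ, N ≠ c + 2 * k)
    (χc : DirichletCharacter R (p ^ c)) (hprim : χc.IsPrimitive) {ζ : R} (hζ : IsPrimitiveRoot ζ (p ^ N)) :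
    ∑ a : ZMod (p ^ N), changeLevel (pow_dvd_pow p hcN) χc a *
        ∑ k ∈ range N, (-1) ^ k * ((ζ ^ p ^ (2 * k)) ^ a.val - 1) / (p : R) ^ k = 0 := by
  have hζN : ζ ^ p ^ N = 1 := hζ.pow_eq_one
  have hne : changeLevel (pow_dvd_pow p hcN) χc ≠ 1 := changeLevel_ne_one_of_isPrimitive hc hcN χc hprim
  rw [sum_mul_ellConj_expand, MulChar.sum_eq_zero_of_ne_one hne]
  simp only [sub_zero]
  refine Finset.sum_eq_zero fun k _ ↦ ?_
  rcases Nat.lt_or_gt_of_ne (show 2 * k + c ≠ N from fun h ↦ hodd k (by omega)) with hlt | hgt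
  · rw [sum_changeLevel_mul_pow_eq_zero_of_lt hc hcN χc hζ hlt, mul_zero]
  · rw [sum_changeLevel_mul_pow_eq_zero_of_gt hc hcN χc hprim hζN hgt, mul_zero]

end Summit.BirchSwinnertonDyer.BirchSwinnertonDyer.Theorems.SignedKatoOffTwo.HondaLogChi

end
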